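import Mathlib
import HarnessLib
import Summits.Langlands.Statement
import Summits.Langlands.Langlands.Theses.PrimeSwitchSplit
import Summits.Langlands.Langlands.Theorems.SatakeWindowCarving
import Literature.NumberTheory.GaloisRepresentations.IntegralGaloisActionProofs
import Literature.NumberTheory.GaloisRepresentations.AlgebraicHeckeCharacterNormValues
import Literature.NumberTheory.GaloisRepresentations.AlgebraicHeckeCharacterGrossencharakterProofs
import Literature.NumberTheory.GaloisRepresentations.HeckeCharacterModulusExponentProofs
import Literature.NumberTheory.Automorphic.BockleHuiIrreducibleGL3WeightProofs

/-!
# `SpreadDecayCarving` — lens-6 (barrier-complement carving), decomp-langlands g31, RESIDUAL MODE — CENSUS TWIN, PART 1 of 2 (texts · dials · EQUIV-layer helpers; part 2 = `SpreadDecayCarvingKernel`: first rungs · kernel · BC5 rungs) of the LAYER-2 node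

This file is the node `HOME/nodes/lens-6-g31-SpreadDecayCarving.lean` with its namespace moved from `…Theses.SpreadDecayCarving` to `…Theorems.SpreadDecayCarving`, the `#print axioms` guards removed and the node theorem `closes` renamed `closes_gww` (registry-owned name); NOTHING is asserted beyond kernel-checked theorems (0 sorry): the pieces SD / DWε, the EQUIV layer εPURE and the print seam TPN are `def … : Prop` COPIES of the route texts (the route decls will be `Iff.rfl`-identical after birth), every theorem is about the target `Theorems.SatakeWindowCarving.GaloisWeightWindow` and the host item `PrimeSwitchSplit.WeakGeometricAutomorphy` (stmt-Langlands-17414) BY NAME. Supports stmt-Langlands-17414.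

TARGET (used BY NAME, never restated): the rank-2 crux of the queued child route `SatakeWindowCarving` (lens-6 g30, crit row 359
CLEARED, census twin p820661), as it stands in the tree:
`Summit.Langlands.Langlands.Theorems.SatakeWindowCarving.GaloisWeightWindow` (GWW) — every IRREDUCIBLE GEOMETRIC
`ρ : Γ_K → GL_n(ℚ̄_ℓ)` has a UNIFORM WEIGHT WINDOW: one real `w` with `q_v^{(w-1)/2} ≤ |ι β| ≤ q_v^{(w+1)/2}` for every root `β` of
every Frobenius characteristic polynomial at almost every place `v` (the Jacquet–Shalika window read on the Galois side).  Host chain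
BY NAME: `GWW → WWA → B_w` (`Theorems.SatakeWindowCarving.closes_child`, `B_w` = `PrimeSwitchSplit.WeakGeometricAutomorphy`,
stmt-Langlands-17414) and `→ Langlands` (`Theorems.SatakeWindowCarving.closes_root` with the host route's W⁺, P, A, R).

THE MECHANISM (print name: the «Deligne–Langlands method», [ACC+ = arXiv:1812.09999, proof of Cor. 7.x «purity», p. 102 of the held
text; LanglandsProblems1970; Deligne, Weil I §3]): a window statement that is UNIVERSAL in `(K, n, ρ)` is SELF-IMPROVING — applied to
the Cartan constituents `V_{kλ} ⊂ Sym^k` of the Zariski-closure constituents of `ρ|_{K'}` it shrinks its own width `1` to `1/k`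
(Chevalley: `kμ` is a weight of `V_{kλ}` for every weight `μ` of `V_λ`; Clifford over `K'/K`; Fontaine: de Rham is ⊗/subquotient
stable; `Frob_w = Frob_v^f`).  Hence, IN PRINT, GWW(universal) ⟹ ε-PURITY of every irreducible geometric `ρ` — GWW's open core is a
Fontaine–Mazur-strength purity statement and the WIDTH of the window is immaterial.  This node makes that visible as a carving of GWW
whose two pieces are the CENTRE and the SPREAD of the Frobenius root cloud:

* DWε `DetWeightEpsilon` (crux r3, WEAKER, ATTACKABLE): the DETERMINANT root `∏ β` has an ε-exact weight `w_d`: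
  `q_v^{w_d/2-ε} ≤ |ι ∏β| ≤ q_v^{w_d/2+ε}` a.e. `v`, every `ε > 0`.  CERTIFIED S-IMPLIED IN KERNEL: `detWeight_of_weakAut : B_w → DWε`
  (central character at Satake level, `centralCharacter_satake_of_cuspidal` = Borel–Jacquet §5.7, and `|Ω(ϖ_v)| = q_v^{-σ}`,
  `HeckeCharacter.exists_norm_valueAtUniformizer_eq_rpow_neg` = Weil BNT VII §7).  CLOSED IN PRINT for all `n` (det ρ is a de Rham
  character ⇒ type-A₀ Hecke character, Serre 1968 III / Patrikis 2019 Prop. 2.2.1 ⇒ weight, Weil 1956); its rank-one instance is PROVED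
  here modulo the ONE named tree fact `FramedGaloisRep.exists_heckeCharacter_of_isDeRhamFramed` (`rankOnePurity_of_fact`, using the
  tree's PROVED Weil purity `HeckeCharacter.HasInfinityType.norm_valueAtUniformizer_sq`).
* SD `SpreadDecay` (crux r2, DECIDING, NEW as a typed object, IDEA-NEEDED): the SPREAD of the root cloud is `q_v^{o(1)}`:
  `|ι β| ≤ q_v^{ε} |ι β'|` for all roots `β, β'` at almost every `v`, every `ε > 0` — purity MODULO THE CENTRE, i.e. exactly the
  twist-invariant (Ramanujan-type) content of purity; blind to every character twist of `ρ`, geometric or not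
  (`hasSpreadDecay_of_projFinite`: PROVED for all projectively-finite `ρ`, e.g. arbitrary twists of Artin representations, where `B_w`
  is the OPEN strong Artin conjecture; `hasSpreadDecay_rankOne`: PROVED outright at `n = 1`).  S-implied modulo the print seam TPN only (`pieces_of_langlands`).
* εPURE `EpsilonPurity` (node-local EQUIV layer): `∃ w ∀ ε>0`, a.e. `v`, every root in `[q_v^{w/2-ε}, q_v^{w/2+ε}]`.
  KERNEL: `epsilonPurity_iff_pieces : εPURE ↔ DWε ∧ SD` (real arithmetic on the root cloud: `#roots = n` by
  `IsAlgClosed.card_roots_eq_natDegree` + `Matrix.charpoly_natDegree_eq_dim`; `|ι ∏β| = ∏|ι β|`; `a ≤ |β| ≤ b ⇒ aⁿ ≤ |∏β| ≤ bⁿ`)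
  and `gww_of_epsilonPurity : εPURE → GWW` (`ε := 1/2`).
* TPN `TensorPowerNarrowing : GWW → εPURE` (ASIDE, print seam, NOT in the cone of `closes_gww`): used only in the necessity
  certificates `pieces_of_gww`, `pieces_of_langlands`, `pieces_iff_target_modTPN`.

EXACTNESS: `closes_gww : DWε → SD → GWW` (kernel, mod NOTHING); `GWW → DWε ∧ SD` mod TPN (print); `B_w → DWε` kernel.
`closes_host : DWε → SD → WWA → B_w`, `closes_root : DWε → SD → WWA → W⁺ → P → A → R → Langlands` (BY NAME through the g30 twin).
RUNGS (BC5): `hasSpreadDecay_of_projFinite` / `ProjFiniteSpreadRung` (SD on projectively finite ρ: PROVED; S there ⊇ strong Artin, OPEN);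
`hasSpreadDecay_rankOne` (SD at n = 1 OUTRIGHT);
`finiteOrderPurityRung` (εPURE, hence DWε and SD, on finite-order ρ, `w = 0`: PROVED); `rankOnePurity_of_fact` (εPURE at `n = 1`
modulo the named fact; closing the g30 plan-only rung: `rankOneWindowRung_of_fact`).

Kernel: Lean 4 + Mathlib, imports = accepted tree modules only; axioms ⊆ {propext, Classical.choice, Quot.sound} (`#print axioms`
guards live in the node file).  No `sorry`.
-/

set_option linter.dupNamespace false -- project-wide option (lakefile weak.linter.dupNamespace); `Summit.Langlands.Langlands` is the mandated namespace

namespace Summit.Langlands.Langlands.Theorems.SpreadDecayCarving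

open Filter Polynomial
open scoped NumberField

/-! ## Route texts (one-line Props over accepted declarations; the GWW binder prefix VERBATIM, new conclusions) -/

/-- crux (rank 2, DECIDING, IDEA-NEEDED): **SPREAD DECAY** — for every irreducible geometric `ρ : Γ_K → GL_n(ℚ̄_ℓ)` and every `ε > 0`,
at almost every place `v` any two roots `β, β'` of a Frobenius characteristic polynomial satisfy `|ι β| ≤ q_v^{ε} |ι β'|` (the root
cloud has spread `q_v^{o(1)}`: purity modulo the centre; invariant under every character twist).  Why it might fail: it contains
ε-Ramanujan at almost all places for every cuspidal π attached to an irreducible ρ (non-polarisable RA π on GL_n/CM, n ≥ 3: open);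
a single irreducible geometric ρ with spread ≥ q_v^{δ} on a set of places of positive density refutes it.  Sources: arXiv:1812.09999
(Cor. «Ramanujan for weight 0 GL₂/CM», proof of purity p. 102: «Deligne–Langlands method»); arXiv:1307.1640 (p. 6, «pure of weight w»);
Goldfeld, GL(n,ℝ) book Thm. 12.5.1 (Luo–Rudnick–Sarnak ceiling `1/2 - 1/(n²+1)`). [conjecture] -/
def SpreadDecay : Prop :=
  ∀ (K : Type) [Field K] [NumberField K] (n : ℕ), 0 < n → ∀ (ℓ : ℕ) [Fact ℓ.Prime] (ι : PadicAlgCl ℓ ≃+* ℂ) (ρ : Literature.NumberTheory.GaloisRepresentations.FramedGaloisRep K (PadicAlgCl ℓ) n), ρ.toGaloisRep.IsIrreducible → ((∀ᶠ v : IsDedekindDomain.HeightOneSpectrum (NumberField.RingOfIntegers K) in cofinite, ρ.IsUnramifiedAt v) ∧ ∀ (v : IsDedekindDomain.HeightOneSpectrum (NumberField.RingOfIntegers K)) (hv : ((ℓ : ℕ) : NumberField.RingOfIntegers K) ∈ v.asIdeal), (Literature.NumberTheory.PAdicHodge.fontainePstAdicCompletion v ℓ hv).IsDeRhamFramed (ρ.toLocal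 v)) → ∀ ε : ℝ, 0 < ε → ∀ᶠ v : IsDedekindDomain.HeightOneSpectrum (NumberField.RingOfIntegers K) in Filter.cofinite, ∀ P : Polynomial (PadicAlgCl ℓ), ρ.HasFrobCharpolyAt v P → ∀ β ∈ P.roots, ∀ β' ∈ P.roots, ‖ι β‖ ≤ (v.residueCard : ℝ) ^ ε * ‖ι β'‖

/-- crux (rank 3, ATTACKABLE — closed in print; S-implied in kernel `detWeight_of_weakAut`): **DETERMINANT WEIGHT** — for every
irreducible geometric `ρ` there is a real `w_d` with `q_v^{w_d/2-ε} ≤ |ι ∏β| ≤ q_v^{w_d/2+ε}` for the product of the Frobenius roots at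
almost every `v`, every `ε > 0` (det ρ has an ε-exact weight).  Why it might fail: as typed it only needs `det ρ` de Rham ⇒ Hecke ⇒
weight (Serre 1968 III, Weil 1956; Patrikis 2019 Prop. 2.2.1) — a typing slip in the pinned Fontaine datum is the only risk; in kernel
it is implied by `B_w`.  Sources: Patrikis2019 (Prop. 2.2.1, Lemma 2.1.3); tree `FramedGaloisRep.exists_heckeCharacter_of_isDeRhamFramed`,
`HeckeCharacter.HasInfinityType.norm_valueAtUniformizer_sq`; BorelJacquetCorvallis1979 §5.7. [conjecture] -/
def DetWeightEpsilon : Prop :=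
  ∀ (K : Type) [Field K] [NumberField K] (n : ℕ), 0 < n → ∀ (ℓ : ℕ) [Fact ℓ.Prime] (ι : PadicAlgCl ℓ ≃+* ℂ) (ρ : Literature.NumberTheory.GaloisRepresentations.FramedGaloisRep K (PadicAlgCl ℓ) n), ρ.toGaloisRep.IsIrreducible → ((∀ᶠ v : IsDedekindDomain.HeightOneSpectrum (NumberField.RingOfIntegers K) in cofinite, ρ.IsUnramifiedAt v) ∧ ∀ (v : IsDedekindDomain.HeightOneSpectrum (NumberField.RingOfIntegers K)) (hv : ((ℓ : ℕ) : NumberField.RingOfIntegers K) ∈ v.asIdeal), (Literature.NumberTheory.PAdicHodge.fontainePstAdicCompletion v ℓ hv).IsDeRhamFramed (ρ.toLocal v)) → ∃ w : ℝ, ∀ ε : ℝ, 0 < ε → ∀ᶠ v : IsDedekindDomain.HeightOneSpectrum (NumberField.RingOfIntegers K) in Filter.cofinite, ∀ P : Polynomial (PadicAlgCl ℓ), ρ.HasFrobCharpolyAt v P → (v.residueCard : ℝ) ^ (w / 2 - ε) ≤ ‖ι P.roots.prod‖ ∧ ‖ι P.roots.prod‖ ≤ (v.residueCard : ℝ) ^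 (w / 2 + ε)

/-- node-local EQUIV layer: **ε-PURITY** — for every irreducible geometric `ρ` there is a real `w` with every Frobenius root in
`[q_v^{w/2-ε}, q_v^{w/2+ε}]` at almost every `v`, every `ε > 0`.  KERNEL: `epsilonPurity_iff_pieces : EpsilonPurity ↔ DWε ∧ SD` and
`gww_of_epsilonPurity : EpsilonPurity → GWW`; conversely `GWW → EpsilonPurity` is the print seam TPN.  Sources: arXiv:1307.1640 p. 6;
arXiv:1812.09999 p. 102. [conjecture] -/
def EpsilonPurity : Prop :=
  ∀ (K : Type) [Field K] [NumberField K] (n : ℕ), 0 < n → ∀ (ℓ : ℕ) [Fact ℓ.Prime] (ι : PadicAlgCl ℓ ≃+* ℂ) (ρ : Literature.NumberTheory.GaloisRepresentations.FramedGaloisRep K (PadicAlgCl ℓ) n), ρ.toGaloisRep.IsIrreducible → ((∀ᶠ v : IsDedekindDomain.HeightOneSpectrum (NumberField.RingOfIntegers K) in cofinite, ρ.IsUnramifiedAt v) ∧ ∀ (v : IsDedekindDomain.HeightOneSpectrum (NumberField.RingOfIntegers K)) (hv : ((ℓ : ℕ) : NumberField.RingOfIntegers K) ∈ v.asIdeal),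 (Literature.NumberTheory.PAdicHodge.fontainePstAdicCompletion v ℓ hv).IsDeRhamFramed (ρ.toLocal v)) → ∃ w : ℝ, ∀ ε : ℝ, 0 < ε → ∀ᶠ v : IsDedekindDomain.HeightOneSpectrum (NumberField.RingOfIntegers K) in Filter.cofinite, ∀ P : Polynomial (PadicAlgCl ℓ), ρ.HasFrobCharpolyAt v P → ∀ β ∈ P.roots, (v.residueCard : ℝ) ^ (w / 2 - ε) ≤ ‖ι β‖ ∧ ‖ι β‖ ≤ (v.residueCard : ℝ) ^ (w / 2 + ε)

/-- ASIDE (print seam, NOT in the cone of `closes_gww`): **TENSOR-POWER NARROWING** (the «Deligne–Langlands method»): the universal window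
statement GWW implies ε-purity — apply GWW to the highest-weight constituents `V_{kλ} ⊂ Sym^k` of the Zariski-closure constituents of
`ρ|_{K'}` (Borel: the Zariski closure of a semisimple image is reductive; Chevalley: `kμ` is a weight of `V_{kλ}` for every weight `μ`
of `V_λ`, and `V_{kλ}` restricted to a Zariski-dense subgroup stays irreducible; Fontaine: de Rham is stable under ⊗ and
subquotients; Clifford for `Γ_{K'} ◁ Γ_K`; `Frob_w = Frob_v^f`), so the width-`1` window of `V_{kλ}` is a width-`1/k` window for
`ρ`, for every `k`.  Sources: arXiv:1812.09999 p. 102 (the method, run with potential automorphy of `Sym^m`); LanglandsProblems1970;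
Deligne Weil I §3 (even tensor powers). [conjecture] -/
def TensorPowerNarrowing : Prop :=
  Summit.Langlands.Langlands.Theorems.SatakeWindowCarving.GaloisWeightWindow → EpsilonPurity

/-- node-local: the Assembly of this layer-2 node (`closes_gww`). -/
def ChildAssembly : Prop :=
  DetWeightEpsilon → SpreadDecay → Summit.Langlands.Langlands.Theorems.SatakeWindowCarving.GaloisWeightWindow

/-! ## The three dials, named per representation -/

section Dial

open IsDedekindDomain NumberField Literature.NumberTheory.GaloisRepresentations

variable (K : Type) [Field K] [NumberField K] (ℓ : ℕ) [Fact ℓ.Prime]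

/-- `ρ` HAS SPREAD DECAY (the SD conclusion, literally). [folklore] -/
def HasSpreadDecay (ι : PadicAlgCl ℓ ≃+* ℂ) {n : ℕ} (ρ : FramedGaloisRep K (PadicAlgCl ℓ) n) : Prop :=
  ∀ ε : ℝ, 0 < ε → ∀ᶠ v : IsDedekindDomain.HeightOneSpectrum (NumberField.RingOfIntegers K) in Filter.cofinite, ∀ P : Polynomial (PadicAlgCl ℓ), ρ.HasFrobCharpolyAt v P → ∀ β ∈ P.roots, ∀ β' ∈ P.roots, ‖ι β‖ ≤ (v.residueCard : ℝ) ^ ε * ‖ι β'‖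

/-- `ρ` HAS A DETERMINANT WEIGHT (the DWε conclusion, literally). [folklore] -/
def HasDetWeight (ι : PadicAlgCl ℓ ≃+* ℂ) {n : ℕ} (ρ : FramedGaloisRep K (PadicAlgCl ℓ) n) : Prop :=
  ∃ w : ℝ, ∀ ε : ℝ, 0 < ε → ∀ᶠ v : IsDedekindDomain.HeightOneSpectrum (NumberField.RingOfIntegers K) in Filter.cofinite, ∀ P : Polynomial (PadicAlgCl ℓ), ρ.HasFrobCharpolyAt v P → (v.residueCard : ℝ) ^ (w / 2 - ε) ≤ ‖ι P.roots.prod‖ ∧ ‖ι P.roots.prod‖ ≤ (v.residueCard : ℝ) ^ (w / 2 + ε)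

/-- `ρ` IS ε-PURE (the εPURE conclusion, literally). [folklore] -/
def IsEpsilonPure (ι : PadicAlgCl ℓ ≃+* ℂ) {n : ℕ} (ρ : FramedGaloisRep K (PadicAlgCl ℓ) n) : Prop :=
  ∃ w : ℝ, ∀ ε : ℝ, 0 < ε → ∀ᶠ v : IsDedekindDomain.HeightOneSpectrum (NumberField.RingOfIntegers K) in Filter.cofinite, ∀ P : Polynomial (PadicAlgCl ℓ), ρ.HasFrobCharpolyAt v P → ∀ β ∈ P.roots, (v.residueCard : ℝ) ^ (w / 2 - ε) ≤ ‖ι β‖ ∧ ‖ι β‖ ≤ (v.residueCard : ℝ) ^ (w / 2 + ε)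

variable {K ℓ}

/-! ### Root-cloud arithmetic (kernel helpers) -/

/-- a Frobenius characteristic polynomial of an `n`-dimensional `ρ` has exactly `n` roots (with multiplicity): it IS the
characteristic polynomial of `ρ(Frob)` (a prime above `v` and a Frobenius exist), monic of degree `n`, split over `ℚ̄_ℓ`. [folklore] -/
theorem card_roots_of_hasFrobCharpolyAt {n : ℕ} (ρ : FramedGaloisRep K (PadicAlgCl ℓ) n) {v : HeightOneSpectrum (𝓞 K)}
    {P : Polynomial (PadicAlgCl ℓ)} (hP : ρ.HasFrobCharpolyAt v P) : Multiset.card P.roots = n := by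
  classical
  obtain ⟨𝔓, h𝔓⟩ := v.primesAbove_nonempty
  obtain ⟨σ, hσ⟩ := HeightOneSpectrum.exists_isArithFrobAt_of_mem_primesAbove_holds h𝔓
  have hPσ : P = ((ρ σ : GL (Fin n) (PadicAlgCl ℓ)) : Matrix (Fin n) (Fin n) (PadicAlgCl ℓ)).charpoly := (hP 𝔓 h𝔓 σ hσ).symm
  rw [hPσ, IsAlgClosed.card_roots_eq_natDegree, Matrix.charpoly_natDegree_eq_dim, Fintype.card_fin]

/-- `|ι (∏ s)| = ∏ |ι s|`. [folklore] -/
theorem norm_map_multiset_prod (ι : PadicAlgCl ℓ ≃+* ℂ) (s : Multiset (PadicAlgCl ℓ)) :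
    ‖ι s.prod‖ = (s.map fun β => ‖ι β‖).prod := by
  induction s using Multiset.induction_on with
  | empty => simp
  | cons a s ih => simp [Multiset.prod_cons, map_mul, ih]

/-- upper product bound: `|ι β| ≤ b` on `s` ⇒ `|ι ∏ s| ≤ b ^ #s`. [folklore] -/
theorem norm_prod_le_pow (ι : PadicAlgCl ℓ ≃+* ℂ) {s : Multiset (PadicAlgCl ℓ)} {b : ℝ} (hb : ∀ β ∈ s, ‖ι β‖ ≤ b) :
    ‖ι s.prod‖ ≤ b ^ Multiset.card s := by
  induction s using Multiset.induction_on with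
  | empty => simp
  | cons a s ih =>
    have ha : ‖ι a‖ ≤ b := hb a (Multiset.mem_cons_self a s)
    have hs : ∀ β ∈ s, ‖ι β‖ ≤ b := fun β hβ => hb β (Multiset.mem_cons_of_mem hβ)
    rw [Multiset.prod_cons, map_mul, norm_mul, Multiset.card_cons, pow_succ']
    exact mul_le_mul ha (ih hs) (norm_nonneg _) ((norm_nonneg _).trans ha)

/-- lower product bound: `0 ≤ a ≤ |ι β|` on `s` ⇒ `a ^ #s ≤ |ι ∏ s|`. [folklore] -/
theorem pow_le_norm_prod (ι : PadicAlgCl ℓ ≃+* ℂ) {s : Multiset (PadicAlgCl ℓ)} {a : ℝ} (ha0 : 0 ≤ a)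
    (ha : ∀ β ∈ s, a ≤ ‖ι β‖) : a ^ Multiset.card s ≤ ‖ι s.prod‖ := by
  induction s using Multiset.induction_on with
  | empty => simp
  | cons b s ih =>
    have hb : a ≤ ‖ι b‖ := ha b (Multiset.mem_cons_self b s)
    have hs : ∀ β ∈ s, a ≤ ‖ι β‖ := fun β hβ => ha β (Multiset.mem_cons_of_mem hβ)
    rw [Multiset.prod_cons, map_mul, norm_mul, Multiset.card_cons, pow_succ']
    exact mul_le_mul hb (ih hs) (pow_nonneg ha0 _) (norm_nonneg _)

/-! ### The EQUIV layer in kernel: `εPURE ↔ DWε ∧ SD` -/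

/-- εPURE ⇒ DWε, with `w_d = n w` (take `ε/n`; `|ι ∏β| = ∏ |ι β|`, `#β = n`). [folklore] -/
theorem hasDetWeight_of_isEpsilonPure (ι : PadicAlgCl ℓ ≃+* ℂ) {n : ℕ} (hn : 0 < n) {ρ : FramedGaloisRep K (PadicAlgCl ℓ) n}
    (h : IsEpsilonPure K ℓ ι ρ) : HasDetWeight K ℓ ι ρ := by
  obtain ⟨w, hw⟩ := h
  have hn' : (0 : ℝ) < n := by exact_mod_cast hn
  have hn0 : (n : ℝ) ≠ 0 := hn'.ne'
  refine ⟨n * w, fun ε hε => ?_⟩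
  filter_upwards [hw (ε / n) (div_pos hε hn')] with v hv P hP
  have hcard := card_roots_of_hasFrobCharpolyAt ρ hP
  have hq0 : (0 : ℝ) ≤ v.residueCard := Nat.cast_nonneg _
  constructor
  · have h1 := pow_le_norm_prod ι (Real.rpow_nonneg hq0 _) (fun β hβ => (hv P hP β hβ).1)
    rw [hcard, ← Real.rpow_natCast, ← Real.rpow_mul hq0] at h1
    convert h1 using 2
    field_simp
  · have h2 := norm_prod_le_pow ι (fun β hβ => (hv P hP β hβ).2)
    rw [hcard, ← Real.rpow_natCast, ← Real.rpow_mul hq0] at h2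
    convert h2 using 2
    field_simp

/-- εPURE ⇒ SD (take `ε/2` on both sides of the centre). [folklore] -/
theorem hasSpreadDecay_of_isEpsilonPure (ι : PadicAlgCl ℓ ≃+* ℂ) {n : ℕ} {ρ : FramedGaloisRep K (PadicAlgCl ℓ) n}
    (h : IsEpsilonPure K ℓ ι ρ) : HasSpreadDecay K ℓ ι ρ := by
  obtain ⟨w, hw⟩ := h
  intro ε hε
  filter_upwards [hw (ε / 2) (half_pos hε)] with v hv P hP β hβ β' hβ'
  have hq0 : (0 : ℝ) < v.residueCard := by exact_mod_cast Nat.zero_lt_of_lt v.one_lt_residueCard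
  have hsplit : (v.residueCard : ℝ) ^ (w / 2 + ε / 2) = (v.residueCard : ℝ) ^ ε * (v.residueCard : ℝ) ^ (w / 2 - ε / 2) := by
    rw [← Real.rpow_add hq0]; congr 1; ring
  calc ‖ι β‖ ≤ (v.residueCard : ℝ) ^ (w / 2 + ε / 2) := (hv P hP β hβ).2
    _ = (v.residueCard : ℝ) ^ ε * (v.residueCard : ℝ) ^ (w / 2 - ε / 2) := hsplit
    _ ≤ (v.residueCard : ℝ) ^ ε * ‖ι β'‖ := mul_le_mul_of_nonneg_left (hv P hP β' hβ').1 (Real.rpow_nonneg hq0.le _)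

/-- DWε ∧ SD ⇒ εPURE, with `w = w_d / n`: each root is within `q^{ε/2}` of every other, so `|β|ⁿ q^{∓nε/2} ≶ |∏β| ≶ q^{w_d/2 ± nε/2}`.
[folklore] -/
theorem isEpsilonPure_of_pieces (ι : PadicAlgCl ℓ ≃+* ℂ) {n : ℕ} (hn : 0 < n) {ρ : FramedGaloisRep K (PadicAlgCl ℓ) n}
    (hD : HasDetWeight K ℓ ι ρ) (hS : HasSpreadDecay K ℓ ι ρ) : IsEpsilonPure K ℓ ι ρ := by
  obtain ⟨wd, hwd⟩ := hD
  have hn' : (0 : ℝ) < n := by exact_mod_cast hn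
  have hn0 : (n : ℝ) ≠ 0 := hn'.ne'
  refine ⟨wd / n, fun ε hε => ?_⟩
  filter_upwards [hwd (n * ε / 2) (by positivity), hS (ε / 2) (half_pos hε)] with v hvD hvS P hP β hβ
  have hcard := card_roots_of_hasFrobCharpolyAt ρ hP
  have hq1 : (1 : ℝ) < v.residueCard := by exact_mod_cast v.one_lt_residueCard
  have hq0 : (0 : ℝ) < v.residueCard := zero_lt_one.trans hq1
  obtain ⟨hDlo, hDhi⟩ := hvD P hP
  have hnn : 0 ≤ ‖ι β‖ := norm_nonneg _
  constructor
  · -- lower bound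
    have hup : ‖ι P.roots.prod‖ ≤ ((v.residueCard : ℝ) ^ (ε / 2) * ‖ι β‖) ^ n := by
      rw [← hcard]
      exact norm_prod_le_pow ι (fun β' hβ' => hvS P hP β' hβ' β hβ)
    have hpow : ((v.residueCard : ℝ) ^ (wd / n / 2 - ε)) ^ n ≤ ‖ι β‖ ^ n := by
      have h3 : (v.residueCard : ℝ) ^ (wd / 2 - n * ε / 2) ≤ ((v.residueCard : ℝ) ^ (ε / 2)) ^ n * ‖ι β‖ ^ n := by
        rw [← mul_pow]; exact hDlo.trans hup
      rw [← Real.rpow_natCast ((v.residueCard : ℝ) ^ (ε / 2)), ← Real.rpow_mul hq0.le] at h3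
      have h4 : (v.residueCard : ℝ) ^ (wd / 2 - n * ε / 2) =
          (v.residueCard : ℝ) ^ (ε / 2 * n) * ((v.residueCard : ℝ) ^ (wd / n / 2 - ε)) ^ n := by
        rw [← Real.rpow_natCast ((v.residueCard : ℝ) ^ (wd / n / 2 - ε)), ← Real.rpow_mul hq0.le, ← Real.rpow_add hq0]
        congr 1; field_simp; ring
      rw [h4] at h3
      exact le_of_mul_le_mul_left h3 (Real.rpow_pos_of_pos hq0 _)
    exact (pow_le_pow_iff_left₀ (Real.rpow_nonneg hq0.le _) hnn hn.ne').1 hpow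
  · -- upper bound
    have hlo : ((v.residueCard : ℝ) ^ (-(ε / 2)) * ‖ι β‖) ^ n ≤ ‖ι P.roots.prod‖ := by
      rw [← hcard]
      refine pow_le_norm_prod ι (mul_nonneg (Real.rpow_nonneg hq0.le _) hnn) (fun β' hβ' => ?_)
      rw [Real.rpow_neg hq0.le, inv_mul_le_iff₀ (Real.rpow_pos_of_pos hq0 _)]
      exact hvS P hP β hβ β' hβ'
    have hpow : ‖ι β‖ ^ n ≤ ((v.residueCard : ℝ) ^ (wd / n / 2 + ε)) ^ n := by
      have h3 : ((v.residueCard : ℝ) ^ (-(ε / 2))) ^ n * ‖ι β‖ ^ n ≤ (v.residueCard : ℝ) ^ (wd / 2 + n * ε / 2) := by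
        rw [← mul_pow]; exact hlo.trans hDhi
      rw [← Real.rpow_natCast ((v.residueCard : ℝ) ^ (-(ε / 2))), ← Real.rpow_mul hq0.le] at h3
      have h4 : (v.residueCard : ℝ) ^ (wd / 2 + n * ε / 2) =
          (v.residueCard : ℝ) ^ (-(ε / 2) * n) * ((v.residueCard : ℝ) ^ (wd / n / 2 + ε)) ^ n := by
        rw [← Real.rpow_natCast ((v.residueCard : ℝ) ^ (wd / n / 2 + ε)), ← Real.rpow_mul hq0.le, ← Real.rpow_add hq0]
        congr 1; field_simp; ring
      rw [h4] at h3
      exact le_of_mul_le_mul_left h3 (Real.rpow_pos_of_pos hq0 _)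
    exact (pow_le_pow_iff_left₀ hnn (Real.rpow_nonneg hq0.le _) hn.ne').1 hpow

/-- **εPURE ↔ DWε ∧ SD** per representation (`0 < n`). [folklore] -/
theorem isEpsilonPure_iff (ι : PadicAlgCl ℓ ≃+* ℂ) {n : ℕ} (hn : 0 < n) (ρ : FramedGaloisRep K (PadicAlgCl ℓ) n) :
    IsEpsilonPure K ℓ ι ρ ↔ (HasDetWeight K ℓ ι ρ ∧ HasSpreadDecay K ℓ ι ρ) :=
  ⟨fun h => ⟨hasDetWeight_of_isEpsilonPure ι hn h, hasSpreadDecay_of_isEpsilonPure ι h⟩,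
    fun h => isEpsilonPure_of_pieces ι hn h.1 h.2⟩

/-- εPURE ⇒ the g30 window (`ε := 1/2`): `q^{w/2 - 1/2} = q^{(w-1)/2}`. [folklore] -/
theorem hasWeightWindow_of_isEpsilonPure (ι : PadicAlgCl ℓ ≃+* ℂ) {n : ℕ} {ρ : FramedGaloisRep K (PadicAlgCl ℓ) n}
    (h : IsEpsilonPure K ℓ ι ρ) : Summit.Langlands.Langlands.Theorems.SatakeWindowCarving.HasWeightWindow K ℓ ι ρ := by
  obtain ⟨w, hw⟩ := h
  refine ⟨w, ?_⟩
  filter_upwards [hw (1 / 2) one_half_pos] with v hv P hP β hβ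
  obtain ⟨h1, h2⟩ := hv P hP β hβ
  constructor
  · convert h1 using 2; ring
  · convert h2 using 2; ring

end Dial

end Summit.Langlands.Langlands.Theorems.SpreadDecayCarving
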